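import Summits.MatrixMultiplication.MatrixMultiplication.Theorems.FarEdgeDescentTameProfile
import Literature.Barriers.MatrixMultiplication.RectangularBarrier
import Literature.Computability.AlgebraicComplexity.AsymptoticSpectrumDuality
import Literature.Computability.AlgebraicComplexity.AsymptoticSpectrumProofs
import Literature.Computability.AlgebraicComplexity.AsymptoticRankMatMul
import Literature.Computability.AlgebraicComplexity.MatMulMonomialSubrankAsymptotics
import Literature.Computability.AlgebraicComplexity.RelativeExponent
import Literature.Computability.AlgebraicComplexity.RectangularExponentAsymptoticRank
import Literature.Computability.AlgebraicComplexity.RectangularExponentSymmetry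
import Literature.Computability.AlgebraicComplexity.TensorRestrictionRank
import HarnessLib

/-!
# Route `FarEdgeDescent` on Strassen's asymptotic spectrum, I: the dictionary

Support module (def-free) for the special crux `FiniteSaturation` (stmt-MatrixMultiplication-23739) of
`Summits/MatrixMultiplication/MatrixMultiplication/Theses/FarEdgeDescent.lean`; the cut of record
`ω = 2 ⟺ FiniteSaturation ∧ AnchoredLogConvexity` is unchanged (`FarEdgeDescentChord.node_iff`).
This file reads the special leaf on `X(K) = asymptoticSpectrum K` (tree `IsUniversalSpectralPoint`) in
MULTIPLICATIVE COORDINATES `u = φ⟨2,1,1⟩`, `v = φ⟨1,2,1⟩`, `w = φ⟨1,1,2⟩ ∈ [1,2]` of a universal spectral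
point `φ` (Alman–Li's `θ = log₂` of these, Def. 4.1); `φ⟨2^a,2^b,2^c⟩ = uᵃ vᵇ wᶜ` (`map_two_pow`).

* **Dictionary.** Strassen duality (tree `strassen_duality_asymptoticRank_holds`) and
  `R̃(⟨q^a,q^b,q^c⟩) = q^{ω(a,b,c)}` (tree `asymptoticRank_matMulTensor_rect`) give
  `2^{ω(a,b,c)} = max_{φ ∈ X} φ⟨2^a,2^b,2^c⟩` (`isGreatest_twoPow`): the rectangular exponent is the
  support function of the spectrum in the directions `(a,b,c) ∈ ℕ³`.  Corollaries: every spectral point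
  has `φ⟨2,2,2⟩ ≥ 4` (`four_le_map_cube`, from the tree's Behrend-type `⟨n,n,n⟩ ≥ ⟨n^{2−ε}⟩`), and
  SYMMETRISATION IN COORDINATES `ω ≤ 3·ω(1,k,1)/(k+2)` for every `k : ℕ` (`omega_le_symmetrised`) —
  sharper than the chord price `3 − 1/k` (`FarEdgeDescentChord.omega_le_three_sub_inv_of_saturated`)
  for `k ≥ 2`.
* **The special leaf is a ROOF over the edge `v = 2`.**  Saturation of the shape `(1,k,1)` IS the bound
  `φ⟨2,2^k,2⟩ ≤ 2^{k+1}` on all of `X` (`roof_iff_saturated`); roofs weaken with `k` (`roof_mono`);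
  price of a roof `ω ≤ 3(k+1)/(k+2)` (`omega_le_of_roof`).
* **Light points.** The gauge point `ζ⁽²⁾` is a universal spectral point ON the edge, `ζ⁽²⁾⟨1,2,1⟩ = 2`
  (`exists_edge_point`).

Part II (`FarEdgeDescentSpectralRoof`) specialises to `ℂ`: `FiniteSaturation ⟺ ∃ k ≥ 2, roof k`, the
summit as the square roof, EDGE RIGIDITY `v = 2 ⟹ uw = 2` (Alman–Li–Pratt 2026, Prop. 8.1) as a
theorem, the generic law as descent engine, and the dark/light dichotomy of far carriers.
Placement [cite: AlmanLi2026, Definition 4.1, Propositions 4.1–4.2] [cite: AlmanLiPratt2026, Prop. 8.1,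
Cor. 8.4] [cite: LottiRomani1983, Prop. 4.1] [cite: Strassen1988, Thm. 3.8]
[cite: ChristandlVranaZuiddam2023, Prop. 1.6, Example 1.4].
Written by the decomp-mm lens-2 planner seat (gen 12); imports only BUILT modules; no new definitions.
-/

set_option linter.dupNamespace false

noncomputable section

namespace Summit.MatrixMultiplication.MatrixMultiplication.Theorems.FarEdgeDescentSpectralEdge

open Literature.Computability.AlgebraicComplexity
open Summit.MatrixMultiplication.MatrixMultiplication.Theses.FarEdgeDescent
open Summit.MatrixMultiplication.MatrixMultiplication.Theorems.FarEdgeDescentChord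
open Summit.MatrixMultiplication.MatrixMultiplication.Theorems.FarEdgeDescentTameProfile

/-! ## §1 Dictionary: values of spectral points on small formats -/

section Dictionary

variable {K : Type} [Field K]

/-- A universal spectral point is an adequate map (CLLZ footnote 3, tree), Strassen duality being a
tree theorem. [cite: ChristandlLeGallLysikovZuiddam2025, §1.3.1 (footnote 3)] -/
theorem isAdequate {F : SpectralMap K} (hF : IsUniversalSpectralPoint K F) :
    Literature.Barriers.MatrixMultiplication.IsAdequate K F :=
  hF.isAdequate (strassen_duality_asymptoticRank_holds K)

/-- `φ⟨1,1,1⟩ = 1`. [cite: ChristandlLeGallLysikovZuiddam2025, Def. 3.1] -/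
theorem map_one_one_one {F : SpectralMap K} (hF : IsUniversalSpectralPoint K F) :
    F (matMulTensor K 1 1 1) = 1 :=
  (isAdequate hF).map_matMul_one (T := unitTensor K 1) (by rw [hF.map_unitTensor_one]; norm_num)

/-- `1 ≤ φ⟨n,m,p⟩` for positive formats. [cite: ChristandlLeGallLysikovZuiddam2025, Def. 3.1] -/
theorem one_le_map {F : SpectralMap K} (hF : IsUniversalSpectralPoint K F) {n m p : ℕ}
    (hn : 1 ≤ n) (hm : 1 ≤ m) (hp : 1 ≤ p) : 1 ≤ F (matMulTensor K n m p) :=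
  (isAdequate hF).one_le_map_matMul (map_one_one_one hF) hn hm hp

/-- `φ⟨n,m,p⟩ ≤ n·m·p` (`⟨n,m,p⟩ ≤ ⟨nmp⟩` by the standard algorithm). [cite: Blaser2013, §5] -/
theorem map_le_card {F : SpectralMap K} (hF : IsUniversalSpectralPoint K F) (n m p : ℕ) :
    F (matMulTensor K n m p) ≤ (n * m * p : ℕ) :=
  calc F (matMulTensor K n m p) ≤ F (unitTensor K (n * m * p)) :=
        hF.mono _ _ (tensorRestrictsTo_unitTensor_of_tensorRank_le _ (tensorRank_matMulTensor_le K n m p))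
    _ = (n * m * p : ℕ) := hF.map_unitTensor _

/-- Powers of a format: `φ⟨n^a, m^a, p^a⟩ = φ⟨n,m,p⟩^a` (MaMu multiplicativity).
[cite: ChristandlLeGallLysikovZuiddam2025, Def. 3.1] -/
theorem map_pow {F : SpectralMap K} (hF : IsUniversalSpectralPoint K F) {n m p : ℕ}
    (hn : 1 ≤ n) (hm : 1 ≤ m) (hp : 1 ≤ p) (a : ℕ) :
    F (matMulTensor K (n ^ a) (m ^ a) (p ^ a)) = F (matMulTensor K n m p) ^ a := by
  induction a with
  | zero =>
    rw [SpectralMap.map_matMulTensor_congr F (pow_zero n) (pow_zero m) (pow_zero p), pow_zero]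
    exact map_one_one_one hF
  | succ a ih =>
    rw [SpectralMap.map_matMulTensor_congr F (pow_succ n a) (pow_succ m a) (pow_succ p a),
      (isAdequate hF).mamu (n ^ a) n (m ^ a) m (p ^ a) p (Nat.one_le_pow _ _ hn) hn
        (Nat.one_le_pow _ _ hm) hm (Nat.one_le_pow _ _ hp) hp, ih, pow_succ]

/-- **Multiplicative coordinates**: `φ⟨2^a,2^b,2^c⟩ = uᵃ vᵇ wᶜ` with `u = φ⟨2,1,1⟩`, `v = φ⟨1,2,1⟩`,
`w = φ⟨1,1,2⟩`. [cite: AlmanLi2026, Proposition 4.1] -/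
theorem map_two_pow {F : SpectralMap K} (hF : IsUniversalSpectralPoint K F) (a b c : ℕ) :
    F (matMulTensor K (2 ^ a) (2 ^ b) (2 ^ c)) =
      F (matMulTensor K 2 1 1) ^ a * F (matMulTensor K 1 2 1) ^ b * F (matMulTensor K 1 1 2) ^ c := by
  have h2 : (1 : ℕ) ≤ 2 := by norm_num
  have ha : F (matMulTensor K (2 ^ a) 1 1) = F (matMulTensor K 2 1 1) ^ a := by
    rw [SpectralMap.map_matMulTensor_congr F (k := 2 ^ a) rfl (one_pow a).symm (one_pow a).symm]
    exact map_pow hF h2 le_rfl le_rfl a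
  have hb : F (matMulTensor K 1 (2 ^ b) 1) = F (matMulTensor K 1 2 1) ^ b := by
    rw [SpectralMap.map_matMulTensor_congr F (m := 2 ^ b) (one_pow b).symm rfl (one_pow b).symm]
    exact map_pow hF le_rfl h2 le_rfl b
  have hc : F (matMulTensor K 1 1 (2 ^ c)) = F (matMulTensor K 1 1 2) ^ c := by
    rw [SpectralMap.map_matMulTensor_congr F (n := 2 ^ c) (one_pow c).symm (one_pow c).symm rfl]
    exact map_pow hF le_rfl le_rfl h2 c
  rw [(isAdequate hF).map_matMul_eq_mul₃ Nat.one_le_two_pow Nat.one_le_two_pow Nat.one_le_two_pow,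
    ha, hb, hc]

/-- The far-edge family in coordinates: `φ⟨2,2^k,2⟩ = φ⟨2,1,2⟩ · v^k` (and `φ⟨2,1,2⟩ = u·w`).
[cite: AlmanLi2026, Proposition 4.1] -/
theorem map_far_eq {F : SpectralMap K} (hF : IsUniversalSpectralPoint K F) (k : ℕ) :
    F (matMulTensor K 2 (2 ^ k) 2) = F (matMulTensor K 2 1 2) * F (matMulTensor K 1 2 1) ^ k := by
  have h2 : (1 : ℕ) ≤ 2 := by norm_num
  rw [← SpectralMap.map_matMulTensor_congr F (pow_one 2) rfl (pow_one 2), map_two_pow hF 1 k 1,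
    (isAdequate hF).map_matMul_eq_mul₃ h2 le_rfl h2, map_one_one_one hF]
  ring

/-- **Strassen duality on power-of-two formats**: `2^{ω(a,b,c)}` is the greatest value of
`φ⟨2^a,2^b,2^c⟩` over the asymptotic spectrum (`R̃ = max_φ φ`, `R̃⟨2^a,2^b,2^c⟩ = 2^{ω(a,b,c)}`).
[cite: Strassen1988, Thm. 3.8] [cite: ChristandlVranaZuiddam2023, Prop. 1.6] -/
theorem isGreatest_twoPow (a b c : ℕ) :
    IsGreatest ((fun F : SpectralMap K => F (matMulTensor K (2 ^ a) (2 ^ b) (2 ^ c))) ''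
      asymptoticSpectrum K) ((2 : ℝ) ^ omegaRect K a b c) := by
  have hR : asymptoticRank (matMulTensor K (2 ^ a) (2 ^ b) (2 ^ c)) = (2 : ℝ) ^ omegaRect K a b c := by
    rw [asymptoticRank_matMulTensor_rect K (le_refl 2) a b c, Nat.cast_ofNat]
  have hD := strassen_duality_asymptoticRank_holds K (matMulTensor K (2 ^ a) (2 ^ b) (2 ^ c))
  refine ⟨?_, ?_⟩
  · obtain ⟨F, hF, hFt⟩ := hD.2
    exact ⟨F, hF, hFt.trans hR⟩
  · rintro _ ⟨F, hF, rfl⟩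
    exact (hD.1 F hF).trans_eq hR

/-- `φ⟨2,2^k,2⟩ ≤ 2^{ω(1,k,1)}` for every spectral point. [cite: Strassen1988, Thm. 3.8] -/
theorem map_far_le {F : SpectralMap K} (hF : IsUniversalSpectralPoint K F) (k : ℕ) :
    F (matMulTensor K 2 (2 ^ k) 2) ≤ (2 : ℝ) ^ omegaRect K 1 k 1 := by
  have h : F (matMulTensor K (2 ^ 1) (2 ^ k) (2 ^ 1)) ≤ (2 : ℝ) ^ omegaRect K (1 : ℕ) k (1 : ℕ) :=
    (isGreatest_twoPow (K := K) 1 k 1).2 ⟨F, hF, rfl⟩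
  rw [SpectralMap.map_matMulTensor_congr F (pow_one 2) rfl (pow_one 2)] at h
  simpa only [Nat.cast_one] using h

/-- The far direction `(1,k,1)` is CARRIED: some spectral point has `φ⟨2,2^k,2⟩ = 2^{ω(1,k,1)}`.
[cite: Strassen1988, Thm. 3.8] -/
theorem exists_far_carrier (k : ℕ) :
    ∃ F : SpectralMap K, IsUniversalSpectralPoint K F ∧
      F (matMulTensor K 2 (2 ^ k) 2) = (2 : ℝ) ^ omegaRect K 1 k 1 := by
  obtain ⟨F, hF, hval⟩ := (isGreatest_twoPow (K := K) 1 k 1).1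
  have h : F (matMulTensor K (2 ^ 1) (2 ^ k) (2 ^ 1)) = (2 : ℝ) ^ omegaRect K (1 : ℕ) k (1 : ℕ) := hval
  rw [SpectralMap.map_matMulTensor_congr F (pow_one 2) rfl (pow_one 2)] at h
  exact ⟨F, hF, by simpa only [Nat.cast_one] using h⟩

/-- **Every spectral point has `φ⟨2,2,2⟩ ≥ 4`** (the asymptotic subrank of `⟨2,2,2⟩` is `4`): from the
tree's Behrend-type monomial degeneration `⟨n,n,n⟩ ≥ ⟨R⟩`, `R ≥ n^{2−ε}` at `n = 2^j`, `φ⟨2,2,2⟩^j ≥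
2^{j(2−ε)}`. [cite: ChristandlVranaZuiddam2023, §1.1] [cite: AlmanLi2026, Proposition 4.2] -/
theorem four_le_map_cube {F : SpectralMap K} (hF : IsUniversalSpectralPoint K F) :
    4 ≤ F (matMulTensor K 2 2 2) := by
  set c := F (matMulTensor K 2 2 2) with hc_def
  have hpow : ∀ j : ℕ, F (matMulTensor K (2 ^ j) (2 ^ j) (2 ^ j)) = c ^ j := fun j =>
    map_pow hF (by norm_num) (by norm_num) (by norm_num) j
  have hc0 : 0 ≤ c := hF.nonneg _
  have hε : ∀ ε : ℝ, 0 < ε → ε ≤ 1 → (2 : ℝ) ^ (2 - ε) ≤ c := by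
    intro ε hε hε1
    obtain ⟨n₀, hn₀⟩ := exists_tensorMonRestrictsTo_matMulTensor_unitTensor K hε hε1
    obtain ⟨R, hR, hres⟩ := hn₀ (2 ^ (n₀ + 1))
      (Nat.lt_two_pow_self.le.trans (Nat.pow_le_pow_right two_pos (Nat.le_succ n₀)))
    have h1 : (R : ℝ) ≤ c ^ (n₀ + 1) := by
      rw [← hpow (n₀ + 1), ← hF.map_unitTensor R]
      exact hF.mono _ _ hres.tensorRestrictsTo
    have h2 : ((2 : ℝ) ^ (2 - ε)) ^ (n₀ + 1) ≤ c ^ (n₀ + 1) := by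
      calc ((2 : ℝ) ^ (2 - ε)) ^ (n₀ + 1) = (((2 ^ (n₀ + 1) : ℕ) : ℝ)) ^ (2 - ε) := by
            push_cast
            rw [← Real.rpow_mul_natCast two_pos.le, mul_comm, Real.rpow_natCast_mul two_pos.le]
        _ ≤ R := hR
        _ ≤ c ^ (n₀ + 1) := h1
    exact (pow_le_pow_iff_left₀ (by positivity) hc0 (Nat.succ_ne_zero n₀)).1 h2
  have h2c : 2 ≤ c := by
    have h := hε 1 one_pos le_rfl
    norm_num at h
    exact h
  have hcpos : 0 < c := by linarith
  by_contra hlt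
  push Not at hlt
  have hL2 : Real.logb 2 c < 2 := by
    rw [Real.logb_lt_iff_lt_rpow one_lt_two hcpos, Real.rpow_two]
    norm_num
    exact hlt
  have hL1 : 1 ≤ Real.logb 2 c := by
    rw [Real.le_logb_iff_rpow_le one_lt_two hcpos, Real.rpow_one]
    exact h2c
  have key := hε ((2 - Real.logb 2 c) / 2) (by linarith) (by linarith)
  have hkey : 2 - (2 - Real.logb 2 c) / 2 ≤ Real.logb 2 c :=
    (Real.le_logb_iff_rpow_le one_lt_two hcpos).2 key
  linarith

/-- **Symmetrisation in coordinates**: `ω ≤ 3·ω(1,k,1)/(k+2)` for every `k : ℕ` — at an `ω`-carrying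
point, `(uvw)^{k+2} = (uᵏvw)(uvᵏw)(uvwᵏ) ≤ 2^{ω(k,1,1)+ω(1,k,1)+ω(1,1,k)} = 2^{3ω(1,k,1)}` by the symmetry
of `ω(·,·,·)`. [cite: LottiRomani1983, §2] -/
theorem omega_le_symmetrised (k : ℕ) : omega K ≤ 3 * omegaRect K 1 k 1 / (k + 2) := by
  obtain ⟨F, hF, hFt⟩ := (strassen_duality_asymptoticRank_holds K (matMulTensor K 2 2 2)).2
  have hR : asymptoticRank (matMulTensor K 2 2 2) = (2 : ℝ) ^ omega K := by
    rw [asymptoticRank_matMulTensor K 2 (by norm_num), Nat.cast_ofNat]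
  rw [hR, ← SpectralMap.map_matMulTensor_congr F (pow_one 2) (pow_one 2) (pow_one 2),
    map_two_pow hF 1 1 1] at hFt
  simp only [pow_one] at hFt
  set u := F (matMulTensor K 2 1 1)
  set v := F (matMulTensor K 1 2 1)
  set w := F (matMulTensor K 1 1 2)
  have hu : 0 ≤ u := hF.nonneg _
  have hv : 0 ≤ v := hF.nonneg _
  have hw : 0 ≤ w := hF.nonneg _
  have h1 : F (matMulTensor K (2 ^ k) (2 ^ 1) (2 ^ 1)) ≤ (2 : ℝ) ^ omegaRect K k (1 : ℕ) (1 : ℕ) :=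
    (isGreatest_twoPow (K := K) k 1 1).2 ⟨F, hF, rfl⟩
  have h2 : F (matMulTensor K (2 ^ 1) (2 ^ k) (2 ^ 1)) ≤ (2 : ℝ) ^ omegaRect K (1 : ℕ) k (1 : ℕ) :=
    (isGreatest_twoPow (K := K) 1 k 1).2 ⟨F, hF, rfl⟩
  have h3 : F (matMulTensor K (2 ^ 1) (2 ^ 1) (2 ^ k)) ≤ (2 : ℝ) ^ omegaRect K (1 : ℕ) (1 : ℕ) k :=
    (isGreatest_twoPow (K := K) 1 1 k).2 ⟨F, hF, rfl⟩
  rw [map_two_pow hF] at h1 h2 h3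
  simp only [pow_one, Nat.cast_one] at h1 h2 h3
  rw [omegaRect_swap₁₂ K (k : ℝ) 1 1] at h1
  rw [← omegaRect_swap₂₃ K 1 (k : ℝ) 1] at h3
  have hprod : (u * v * w) ^ (k + 2) ≤
      (2 : ℝ) ^ omegaRect K 1 k 1 * (2 : ℝ) ^ omegaRect K 1 k 1 * (2 : ℝ) ^ omegaRect K 1 k 1 := by
    have e : (u * v * w) ^ (k + 2) = (u ^ k * v * w) * (u * v ^ k * w) * (u * v * w ^ k) := by ring
    rw [e]
    exact mul_le_mul (mul_le_mul h1 h2 (mul_nonneg (mul_nonneg hu (pow_nonneg hv k)) hw)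
      (by positivity)) h3 (mul_nonneg (mul_nonneg hu hv) (pow_nonneg hw k)) (by positivity)
  have e3 : (2 : ℝ) ^ (3 * omegaRect K 1 k 1) =
      (2 : ℝ) ^ omegaRect K 1 k 1 * (2 : ℝ) ^ omegaRect K 1 k 1 * (2 : ℝ) ^ omegaRect K 1 k 1 := by
    rw [show (3 : ℝ) * omegaRect K 1 k 1 = omegaRect K 1 k 1 + omegaRect K 1 k 1 + omegaRect K 1 k 1
      by ring, Real.rpow_add two_pos, Real.rpow_add two_pos]
  rw [hFt, ← e3, ← Real.rpow_mul_natCast two_pos.le] at hprod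
  push_cast at hprod
  have hle := (Real.rpow_le_rpow_left_iff one_lt_two).1 hprod
  rw [le_div_iff₀ (by positivity)]
  linarith

/-! ## §2 The special leaf: saturation of `(1,k,1)` is a ROOF `φ⟨2,2^k,2⟩ ≤ 2^{k+1}` on `X` -/

/-- **Roof ⟺ saturation**: `φ⟨2,2^k,2⟩ ≤ 2^{k+1}` for every spectral point iff `ω(1,k,1) = k + 1`
(the information bound `ω(1,k,1) ≥ k+1`, tree `add_one_le_omegaRect_one_mid_one`, is the other
inequality). [cite: LottiRomani1983, Prop. 4.1] -/
theorem roof_iff_saturated (k : ℕ) :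
    (∀ F : SpectralMap K, IsUniversalSpectralPoint K F →
        F (matMulTensor K 2 (2 ^ k) 2) ≤ (2 : ℝ) ^ ((k : ℝ) + 1)) ↔
      omegaRect K 1 k 1 = k + 1 := by
  constructor
  · intro h
    refine le_antisymm ?_ (add_one_le_omegaRect_one_mid_one K k)
    obtain ⟨F, hF, hval⟩ := exists_far_carrier (K := K) k
    have h2 := h F hF
    rw [hval] at h2
    exact (Real.rpow_le_rpow_left_iff one_lt_two).1 h2
  · intro hs F hF
    have h := map_far_le hF k
    rwa [hs] at h

/-- Roofs weaken with `k` (since `v ≤ 2`): `roof k ⟹ roof k'` for `k ≤ k'`. [cite: AlmanLi2026, Proposition 4.2] -/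
theorem roof_mono {k k' : ℕ} (hkk' : k ≤ k')
    (h : ∀ F : SpectralMap K, IsUniversalSpectralPoint K F →
      F (matMulTensor K 2 (2 ^ k) 2) ≤ (2 : ℝ) ^ ((k : ℝ) + 1)) :
    ∀ F : SpectralMap K, IsUniversalSpectralPoint K F →
      F (matMulTensor K 2 (2 ^ k') 2) ≤ (2 : ℝ) ^ ((k' : ℝ) + 1) := by
  intro F hF
  have hv2 : F (matMulTensor K 1 2 1) ≤ 2 := by
    have h' := map_le_card hF 1 2 1
    norm_num at h'
    exact h'
  have hv0 : 0 ≤ F (matMulTensor K 1 2 1) := hF.nonneg _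
  have hs0 : 0 ≤ F (matMulTensor K 2 1 2) := hF.nonneg _
  obtain ⟨d, rfl⟩ := Nat.exists_eq_add_of_le hkk'
  have hk := h F hF
  rw [map_far_eq hF] at hk ⊢
  have hvd : F (matMulTensor K 1 2 1) ^ d ≤ 2 ^ d := pow_le_pow_left₀ hv0 hv2 d
  calc F (matMulTensor K 2 1 2) * F (matMulTensor K 1 2 1) ^ (k + d)
        = F (matMulTensor K 2 1 2) * F (matMulTensor K 1 2 1) ^ k * F (matMulTensor K 1 2 1) ^ d := by
          rw [pow_add, mul_assoc]
    _ ≤ (2 : ℝ) ^ ((k : ℝ) + 1) * 2 ^ d :=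
          mul_le_mul hk hvd (pow_nonneg hv0 d) (by positivity)
    _ = (2 : ℝ) ^ (((k + d : ℕ) : ℝ) + 1) := by
          rw [← Real.rpow_natCast (2 : ℝ) d, ← Real.rpow_add two_pos]
          push_cast
          ring_nf

/-- **Price of a roof** (closing at the square by symmetrisation): `roof k ⟹ ω ≤ 3(k+1)/(k+2)`.
[cite: LottiRomani1983, §2] -/
theorem omega_le_of_roof {k : ℕ}
    (h : ∀ F : SpectralMap K, IsUniversalSpectralPoint K F →
      F (matMulTensor K 2 (2 ^ k) 2) ≤ (2 : ℝ) ^ ((k : ℝ) + 1)) :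
    omega K ≤ 3 * (k + 1) / (k + 2) := by
  have hs := (roof_iff_saturated k).1 h
  have h' := omega_le_symmetrised (K := K) k
  rwa [hs] at h'

end Dictionary

/-! ## §3 A light point: the gauge point `ζ⁽²⁾` lies on the edge -/

section Light

variable {K : Type} [Field K]

/-- **A light point exists**: the gauge point `ζ⁽²⁾` is a universal spectral point ON the edge,
`ζ⁽²⁾⟨1,2,1⟩ = 2` (`θ(ζ⁽²⁾) = (1,1,0)`, a vertex of Alman–Li's hexagon).  The value is computed here
for this one format (swap the first two legs, reindex, `ζ⁽¹⁾(⟨1⟩ ⊠ ⟨1,1,2⟩) = 1·(1·2)` by the tree's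
`flatteningRank_multiple_matMulTensor`); the general `ζ⁽²⁾⟨k,m,n⟩ = km` is
`AlmanLi2026SpectrumMatMul.gaugePoint₂_matMulTensor`. [cite: ChristandlVranaZuiddam2023, Example 1.4]
[cite: AlmanLi2026, Proposition 4.2] -/
theorem exists_edge_point :
    ∃ F : SpectralMap K, IsUniversalSpectralPoint K F ∧ F (matMulTensor K 1 2 1) = 2 := by
  refine ⟨gaugePoint₂ K, gaugePoint₂_isUniversalSpectralPoint K, ?_⟩
  have hswap : (fun b a c => matMulTensor K 1 2 1 a b c) =
      fun x y z => matMulTensor K 1 1 2 x y (Prod.swap z) := by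
    funext x y z
    obtain ⟨x₁, x₂⟩ := x; obtain ⟨y₁, y₂⟩ := y; obtain ⟨z₁, z₂⟩ := z
    simp only [matMulTensor, Prod.swap_prod_mk]
    exact if_congr ⟨fun ⟨h1, h2, h3⟩ => ⟨h1.symm, h3, h2⟩, fun ⟨h1, h2, h3⟩ => ⟨h1.symm, h3, h2⟩⟩
      rfl rfl
  have h1 : gaugePoint₁ K (matMulTensor K 1 1 2) = 2 := by
    have hG := gaugePoint₁_isUniversalSpectralPoint K
    have h := hG.map_kronecker (unitTensor K 1) (matMulTensor K 1 1 2)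
    rw [hG.map_unitTensor_one, one_mul, gaugePoint₁_eq,
      flatteningRank_multiple_matMulTensor 1 1 1 2 Nat.one_pos] at h
    rw [← h]
    norm_num
  rw [gaugePoint₂_eq_gaugePoint₁_swap, hswap, gaugePoint₁_eq,
    show (fun x y z => matMulTensor K 1 1 2 x y (Prod.swap z)) =
      fun x y z => matMulTensor K 1 1 2 ((Equiv.refl _) x) ((Equiv.refl _) y)
        ((Equiv.prodComm _ _) z) from rfl,
    flatteningRank_reindex, ← gaugePoint₁_eq, h1]

end Light

end Summit.MatrixMultiplication.MatrixMultiplication.Theorems.FarEdgeDescentSpectralEdge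

end
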